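import Summits.QuantumFields.YangMills.Theorems.PoincareLipschitzSobolevPlanarDecayLetters
import HarnessLib

/-!
# Decay at infinity of planar Sobolev functions with finite Dirichlet energy

Helper (def-free) for ROAD (W) of crux `stmt-QuantumFields-23533` (S1″ / the (GAP) socket), memo `ROAD-W-WENTE-3PI-w3g16.md`
§2 (W-ONE) (d) and the located seam of 2026-08-29 17:05Z («the decay row must be the GENERAL one, for the partners `a b`
too»): the decay row consumed by the removable-pole step of brick W-INV.  For EVERY `v ∈ W^{1,1}_loc(ℝ²)` with `v ∈ L²_loc`
and `∇v ∈ L²(ℝ²)` — no equation, no bounded means —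

  `∫_{‖x − c‖ > 1} v(x)² / ‖x − c‖⁴ dx < ∞`       (`integrableOn_sq_div_norm_pow_four`).

Route (dyadic Poincaré; §1–§2 and the series/weight/Riesz letters are in the sibling `…SobolevPlanarDecayLetters`):
* §1 (P) the SCALE-INVARIANT `L^p` POINCARÉ–WIRTINGER INEQUALITY ON BALLS `‖f − ⨍_B f‖_{L^p(B)} ≤ C·r·‖g‖_{L^p(B)}` on every
  ball `B = B(x₀, r)` of a finite-dimensional real inner-product space (unit ball: the tree's `poincare_wirtinger_holds`;
  transport by `x = x₀ + r y` with the letters of `SobolevBallScaling` — the same route as `exists_eLpNorm_sub_average_le_ball`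
  there, without the Sobolev step, which needs `p < n` and is unavailable at `p = n = 2`);
* §2 (M) on the dyadic balls `B_k = B(c, 2^k)` the means `m_k = ⨍_{B_k} v` satisfy `|m_k − m_{k+1}|·|B_k|^{1/2} ≤ 3C·2^k·‖∇v‖₂`,
  hence grow at most linearly in `k`, and `‖v‖_{L²(B_{k+1})} ≤ 2^{k+1}·(k + 2)·T` with a finite constant `T`;
* §3 (S) on the annulus `A_k = {2^k ≤ ‖x − c‖ < 2^{k+1}}` the weight is `≤ 16^{−k}`, so `∫_{A_k} v²/‖x−c‖⁴ ≤ 4·4^{−k}(k+2)²T²`,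
  and `Σ_k (k+2)² 4^{−k} < ∞`.

HONEST: plane Sobolev bookkeeping; proves nothing of (ONE′)/(W-OSC)/(F′)/(GAP)/(TM)/S1″/`BlockLipschitzL`/`HistoryTailL`;
rung R3 = YM₃ on T³ — NOT d = 4, NOT infinite volume, NOT a mass gap, NOT Clay.
-/

set_option autoImplicit false

noncomputable section

namespace Summit.QuantumFields.YangMills.Theorems.PoincareLipschitzSobolevPlanarDecay

open MeasureTheory Set Function Filter TopologicalSpace Metric Module
open Literature.Analysis.FunctionSpaces
open scoped NNReal ENNReal Topology

/-! ## §3 (M)+(S) Dyadic means grow linearly; the annular sums converge; the decay row -/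

section Decay

variable {v : EuclideanSpace ℝ (Fin 2) → ℝ}
  {Gv : EuclideanSpace ℝ (Fin 2) → EuclideanSpace ℝ (Fin 2) →L[ℝ] ℝ}

/-- A Sobolev function on the plane with `v ∈ L²_loc` and `∇v ∈ L²` lies in `W^{1,2}` of every ball, with the same weak
gradient. [folklore] -/
theorem memSobolevDomain_ball
    (hv : HasWeakFDerivOn (⟨univ, isOpen_univ⟩ : Opens (EuclideanSpace ℝ (Fin 2))) volume v Gv)
    (hv2 : LocallyIntegrable (fun y => v y ^ 2)) (hGv : MemLp Gv 2 volume)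
    (c : EuclideanSpace ℝ (Fin 2)) (r : ℝ) :
    MemSobolevDomain 1 2 (⟨ball c r, isOpen_ball⟩ : Opens (EuclideanSpace ℝ (Fin 2))) volume v ∧
      HasWeakFDerivOn (⟨ball c r, isOpen_ball⟩ : Opens (EuclideanSpace ℝ (Fin 2))) volume v Gv := by
  have hvm : AEStronglyMeasurable v volume :=
    (locallyIntegrableOn_univ.mp hv.locallyIntegrableOn).aestronglyMeasurable
  have hvB : HasWeakFDerivOn (⟨ball c r, isOpen_ball⟩ : Opens (EuclideanSpace ℝ (Fin 2))) volume v Gv :=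
    HasWeakFDerivOn.mono_set_holds hv (fun _ _ => mem_univ _)
  have hvL2 : MemLp v 2 (volume.restrict (ball c r)) := by
    refine (memLp_two_iff_integrable_sq hvm.restrict).2 ?_
    exact (hv2.integrableOn_isCompact (isCompact_closedBall c r)).mono_set ball_subset_closedBall
  refine ⟨(memSobolevDomain_succ_iff (k := 0)).2 ⟨hvL2, Gv, hvB, fun w => ?_⟩, hvB⟩
  rw [memSobolevDomain_zero_iff]
  have hGw : AEStronglyMeasurable (fun x => Gv x w) volume :=
    (ContinuousLinearMap.apply ℝ ℝ w).continuous.comp_aestronglyMeasurable hGv.1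
  have key : MemLp (fun x => Gv x w) 2 (volume.restrict (ball c r)) :=
    MemLp.of_le_mul (c := ‖w‖) (hGv.restrict (ball c r)) hGw.restrict
      (Eventually.of_forall fun x => by rw [mul_comm]; exact (Gv x).le_opNorm w)
  exact key

/-- **(P) on the plane with the global energy**: `‖v − ⨍_{B(c,r)} v‖_{L²(B(c,r))} ≤ C·r·‖∇v‖_{L²(ℝ²)}`. [folklore] -/
theorem eLpNorm_sub_average_ball_le {C : ℝ≥0}
    (hC : ∀ (x₀ : EuclideanSpace ℝ (Fin 2)) (r : ℝ), 0 < r →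
      ∀ (f : EuclideanSpace ℝ (Fin 2) → ℝ) (g : EuclideanSpace ℝ (Fin 2) → EuclideanSpace ℝ (Fin 2) →L[ℝ] ℝ),
      MemSobolevDomain 1 ((2 : ℝ≥0) : ℝ≥0∞) (⟨ball x₀ r, isOpen_ball⟩ : Opens (EuclideanSpace ℝ (Fin 2))) volume f →
      HasWeakFDerivOn (⟨ball x₀ r, isOpen_ball⟩ : Opens (EuclideanSpace ℝ (Fin 2))) volume f g →
      eLpNorm (fun x => f x - ⨍ y in ball x₀ r, f y) (2 : ℝ≥0) (volume.restrict (ball x₀ r)) ≤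
        C * ENNReal.ofReal r * eLpNorm g (2 : ℝ≥0) (volume.restrict (ball x₀ r)))
    (hv : HasWeakFDerivOn (⟨univ, isOpen_univ⟩ : Opens (EuclideanSpace ℝ (Fin 2))) volume v Gv)
    (hv2 : LocallyIntegrable (fun y => v y ^ 2)) (hGv : MemLp Gv 2 volume)
    (c : EuclideanSpace ℝ (Fin 2)) {r : ℝ} (hr : 0 < r) :
    eLpNorm (fun x => v x - ⨍ y in ball c r, v y) 2 (volume.restrict (ball c r))
      ≤ C * ENNReal.ofReal r * eLpNorm Gv 2 volume := by
  obtain ⟨h1, h2⟩ := memSobolevDomain_ball hv hv2 hGv c r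
  have h := hC c r hr v Gv (by exact_mod_cast h1) h2
  have h' : eLpNorm (fun x => v x - ⨍ y in ball c r, v y) 2 (volume.restrict (ball c r))
      ≤ C * ENNReal.ofReal r * eLpNorm Gv 2 (volume.restrict (ball c r)) := by exact_mod_cast h
  exact h'.trans (mul_le_mul_of_nonneg_left (eLpNorm_mono_measure Gv Measure.restrict_le_self) zero_le)

/-- **(M) consecutive dyadic means**: `|m_k − m_{k+1}| · |B(c,1)|^{1/2} ≤ 3C·‖∇v‖₂`, where `m_k = ⨍_{B(c,2^k)} v`.
[folklore] -/
theorem enorm_sub_average_dyadic_le {C : ℝ≥0}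
    (hC : ∀ (x₀ : EuclideanSpace ℝ (Fin 2)) (r : ℝ), 0 < r →
      ∀ (f : EuclideanSpace ℝ (Fin 2) → ℝ) (g : EuclideanSpace ℝ (Fin 2) → EuclideanSpace ℝ (Fin 2) →L[ℝ] ℝ),
      MemSobolevDomain 1 ((2 : ℝ≥0) : ℝ≥0∞) (⟨ball x₀ r, isOpen_ball⟩ : Opens (EuclideanSpace ℝ (Fin 2))) volume f →
      HasWeakFDerivOn (⟨ball x₀ r, isOpen_ball⟩ : Opens (EuclideanSpace ℝ (Fin 2))) volume f g →
      eLpNorm (fun x => f x - ⨍ y in ball x₀ r, f y) (2 : ℝ≥0) (volume.restrict (ball x₀ r)) ≤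
        C * ENNReal.ofReal r * eLpNorm g (2 : ℝ≥0) (volume.restrict (ball x₀ r)))
    (hv : HasWeakFDerivOn (⟨univ, isOpen_univ⟩ : Opens (EuclideanSpace ℝ (Fin 2))) volume v Gv)
    (hv2 : LocallyIntegrable (fun y => v y ^ 2)) (hGv : MemLp Gv 2 volume)
    (c : EuclideanSpace ℝ (Fin 2)) (k : ℕ) :
    ‖(⨍ y in ball c (2 ^ k), v y) - ⨍ y in ball c (2 ^ (k + 1)), v y‖ₑ * volume (ball c 1) ^ (1 / 2 : ℝ)
      ≤ 3 * C * eLpNorm Gv 2 volume := by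
  set m₀ : ℝ := ⨍ y in ball c (2 ^ k), v y with hm₀
  set m₁ : ℝ := ⨍ y in ball c (2 ^ (k + 1)), v y with hm₁
  set EG := eLpNorm Gv 2 volume with hEG
  have hvm : AEStronglyMeasurable v volume :=
    (locallyIntegrableOn_univ.mp hv.locallyIntegrableOn).aestronglyMeasurable
  have h2k : (0 : ℝ) < 2 ^ k := by positivity
  have h2k1 : (0 : ℝ) < 2 ^ (k + 1) := by positivity
  -- volumes: |B_k|^{1/2} = 2^k |B_0|^{1/2}
  have hvolk := sqrt_volume_ball_two_pow c k
  -- the two Poincaré bounds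
  have hP₀ := eLpNorm_sub_average_ball_le hC hv hv2 hGv c h2k
  have hP₁ := eLpNorm_sub_average_ball_le hC hv hv2 hGv c h2k1
  rw [← hm₀] at hP₀
  rw [← hm₁] at hP₁
  -- restriction from B_{k+1} to B_k
  have hsub : ball c (2 ^ k) ⊆ ball c (2 ^ (k + 1)) :=
    ball_subset_ball (by rw [pow_succ]; linarith)
  have hP₁' : eLpNorm (fun x => v x - m₁) 2 (volume.restrict (ball c (2 ^ k)))
      ≤ C * ENNReal.ofReal (2 ^ (k + 1)) * EG :=
    (eLpNorm_mono_measure _ (Measure.restrict_mono hsub le_rfl)).trans hP₁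
  -- the constant as a difference of two centred functions
  have hconst : eLpNorm (fun _ : EuclideanSpace ℝ (Fin 2) => m₀ - m₁) 2 (volume.restrict (ball c (2 ^ k)))
      ≤ eLpNorm (fun x => v x - m₁) 2 (volume.restrict (ball c (2 ^ k)))
        + eLpNorm (fun x => v x - m₀) 2 (volume.restrict (ball c (2 ^ k))) := by
    have heq : (fun _ : EuclideanSpace ℝ (Fin 2) => m₀ - m₁)
        = (fun x => v x - m₁) - (fun x => v x - m₀) := by
      funext x; simp only [Pi.sub_apply]; ring
    rw [heq]
    exact eLpNorm_sub_le (hvm.restrict.sub aestronglyMeasurable_const)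
      (hvm.restrict.sub aestronglyMeasurable_const) (by norm_num)
  rw [eLpNorm_const_two_ball (m₀ - m₁) c h2k, hvolk] at hconst
  -- collect: ‖m₀ − m₁‖ · 2^k · s₀ ≤ C·2^{k+1}·EG + C·2^k·EG = 3C·2^k·EG
  have h2 : ENNReal.ofReal ((2 : ℝ) ^ k) = 2 ^ k := by
    rw [ENNReal.ofReal_pow (by norm_num), ENNReal.ofReal_ofNat]
  have h2' : ENNReal.ofReal ((2 : ℝ) ^ (k + 1)) = 2 * 2 ^ k := by
    rw [ENNReal.ofReal_pow (by norm_num), ENNReal.ofReal_ofNat, pow_succ, mul_comm]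
  rw [h2] at hP₀
  rw [h2'] at hP₁'
  have hmain : ‖m₀ - m₁‖ₑ * volume (ball c 1) ^ (1 / 2 : ℝ) * 2 ^ k ≤ 3 * C * EG * 2 ^ k := by
    calc ‖m₀ - m₁‖ₑ * volume (ball c 1) ^ (1 / 2 : ℝ) * 2 ^ k
        = ‖m₀ - m₁‖ₑ * (2 ^ k * volume (ball c 1) ^ (1 / 2 : ℝ)) := by ring
      _ ≤ C * (2 * 2 ^ k) * EG + C * 2 ^ k * EG := hconst.trans (add_le_add hP₁' hP₀)
      _ = 3 * C * EG * 2 ^ k := by ring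
  have hk0 : (2 : ℝ≥0∞) ^ k ≠ 0 := pow_ne_zero _ two_ne_zero
  have hkt : (2 : ℝ≥0∞) ^ k ≠ ⊤ := ENNReal.pow_ne_top ENNReal.ofNat_ne_top
  exact (ENNReal.mul_le_mul_iff_left hk0 hkt).mp hmain

/-- **(M) linear growth of the dyadic means**: `|m_k| · |B(c,1)|^{1/2} ≤ |m_0| · |B(c,1)|^{1/2} + k · 3C‖∇v‖₂`. [folklore] -/
theorem enorm_average_dyadic_le {C : ℝ≥0}
    (hC : ∀ (x₀ : EuclideanSpace ℝ (Fin 2)) (r : ℝ), 0 < r →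
      ∀ (f : EuclideanSpace ℝ (Fin 2) → ℝ) (g : EuclideanSpace ℝ (Fin 2) → EuclideanSpace ℝ (Fin 2) →L[ℝ] ℝ),
      MemSobolevDomain 1 ((2 : ℝ≥0) : ℝ≥0∞) (⟨ball x₀ r, isOpen_ball⟩ : Opens (EuclideanSpace ℝ (Fin 2))) volume f →
      HasWeakFDerivOn (⟨ball x₀ r, isOpen_ball⟩ : Opens (EuclideanSpace ℝ (Fin 2))) volume f g →
      eLpNorm (fun x => f x - ⨍ y in ball x₀ r, f y) (2 : ℝ≥0) (volume.restrict (ball x₀ r)) ≤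
        C * ENNReal.ofReal r * eLpNorm g (2 : ℝ≥0) (volume.restrict (ball x₀ r)))
    (hv : HasWeakFDerivOn (⟨univ, isOpen_univ⟩ : Opens (EuclideanSpace ℝ (Fin 2))) volume v Gv)
    (hv2 : LocallyIntegrable (fun y => v y ^ 2)) (hGv : MemLp Gv 2 volume)
    (c : EuclideanSpace ℝ (Fin 2)) (k : ℕ) :
    ‖⨍ y in ball c (2 ^ k), v y‖ₑ * volume (ball c 1) ^ (1 / 2 : ℝ)
      ≤ ‖⨍ y in ball c 1, v y‖ₑ * volume (ball c 1) ^ (1 / 2 : ℝ) + k * (3 * C * eLpNorm Gv 2 volume) := by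
  induction k with
  | zero => simp
  | succ j ih =>
    have hstep := enorm_sub_average_dyadic_le hC hv hv2 hGv c j
    have htri : ‖⨍ y in ball c (2 ^ (j + 1)), v y‖ₑ
        ≤ ‖⨍ y in ball c (2 ^ j), v y‖ₑ + ‖(⨍ y in ball c (2 ^ j), v y) - ⨍ y in ball c (2 ^ (j + 1)), v y‖ₑ := by
      have := enorm_sub_le (a := ⨍ y in ball c (2 ^ j), v y)
        (b := (⨍ y in ball c (2 ^ j), v y) - ⨍ y in ball c (2 ^ (j + 1)), v y)
      rwa [sub_sub_cancel] at this
    calc ‖⨍ y in ball c (2 ^ (j + 1)), v y‖ₑ * volume (ball c 1) ^ (1 / 2 : ℝ)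
        ≤ (‖⨍ y in ball c (2 ^ j), v y‖ₑ
            + ‖(⨍ y in ball c (2 ^ j), v y) - ⨍ y in ball c (2 ^ (j + 1)), v y‖ₑ)
            * volume (ball c 1) ^ (1 / 2 : ℝ) := mul_le_mul_of_nonneg_right htri zero_le
      _ = ‖⨍ y in ball c (2 ^ j), v y‖ₑ * volume (ball c 1) ^ (1 / 2 : ℝ)
            + ‖(⨍ y in ball c (2 ^ j), v y) - ⨍ y in ball c (2 ^ (j + 1)), v y‖ₑ
              * volume (ball c 1) ^ (1 / 2 : ℝ) := add_mul _ _ _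
      _ ≤ (‖⨍ y in ball c 1, v y‖ₑ * volume (ball c 1) ^ (1 / 2 : ℝ) + j * (3 * C * eLpNorm Gv 2 volume))
            + 3 * C * eLpNorm Gv 2 volume := add_le_add ih hstep
      _ = ‖⨍ y in ball c 1, v y‖ₑ * volume (ball c 1) ^ (1 / 2 : ℝ)
            + ((j + 1 : ℕ) : ℝ≥0∞) * (3 * C * eLpNorm Gv 2 volume) := by push_cast; ring

/-- **(S) the `L²` mass of `v` on the dyadic ball `B(c, 2^{k+1})`**: at most `2^{k+1}·(k+2)·T` with the finite constant
`T = C‖∇v‖₂ + |m_0|·|B(c,1)|^{1/2} + 3C‖∇v‖₂`. [folklore] -/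
theorem eLpNorm_dyadic_ball_le {C : ℝ≥0}
    (hC : ∀ (x₀ : EuclideanSpace ℝ (Fin 2)) (r : ℝ), 0 < r →
      ∀ (f : EuclideanSpace ℝ (Fin 2) → ℝ) (g : EuclideanSpace ℝ (Fin 2) → EuclideanSpace ℝ (Fin 2) →L[ℝ] ℝ),
      MemSobolevDomain 1 ((2 : ℝ≥0) : ℝ≥0∞) (⟨ball x₀ r, isOpen_ball⟩ : Opens (EuclideanSpace ℝ (Fin 2))) volume f →
      HasWeakFDerivOn (⟨ball x₀ r, isOpen_ball⟩ : Opens (EuclideanSpace ℝ (Fin 2))) volume f g →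
      eLpNorm (fun x => f x - ⨍ y in ball x₀ r, f y) (2 : ℝ≥0) (volume.restrict (ball x₀ r)) ≤
        C * ENNReal.ofReal r * eLpNorm g (2 : ℝ≥0) (volume.restrict (ball x₀ r)))
    (hv : HasWeakFDerivOn (⟨univ, isOpen_univ⟩ : Opens (EuclideanSpace ℝ (Fin 2))) volume v Gv)
    (hv2 : LocallyIntegrable (fun y => v y ^ 2)) (hGv : MemLp Gv 2 volume)
    (c : EuclideanSpace ℝ (Fin 2)) (k : ℕ) :
    eLpNorm v 2 (volume.restrict (ball c (2 ^ (k + 1))))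
      ≤ 2 ^ (k + 1) * ((k + 2 : ℕ) : ℝ≥0∞) *
        (C * eLpNorm Gv 2 volume + ‖⨍ y in ball c 1, v y‖ₑ * volume (ball c 1) ^ (1 / 2 : ℝ)
          + 3 * C * eLpNorm Gv 2 volume) := by
  set EG := eLpNorm Gv 2 volume with hEG
  set s₀ := volume (ball c 1) ^ (1 / 2 : ℝ) with hs₀
  set N₀ := ‖⨍ y in ball c 1, v y‖ₑ with hN₀
  set m₁ : ℝ := ⨍ y in ball c (2 ^ (k + 1)), v y with hm₁
  have hvm : AEStronglyMeasurable v volume :=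
    (locallyIntegrableOn_univ.mp hv.locallyIntegrableOn).aestronglyMeasurable
  have h2k1 : (0 : ℝ) < 2 ^ (k + 1) := by positivity
  -- Poincaré on B_{k+1}
  have hP := eLpNorm_sub_average_ball_le hC hv hv2 hGv c h2k1
  rw [← hm₁, show ENNReal.ofReal ((2 : ℝ) ^ (k + 1)) = 2 ^ (k + 1) by
    rw [ENNReal.ofReal_pow (by norm_num), ENNReal.ofReal_ofNat]] at hP
  -- the mean on B_{k+1}
  have hM := enorm_average_dyadic_le hC hv hv2 hGv c (k + 1)
  rw [← hm₁] at hM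
  -- volumes
  have hvolk : volume (ball c (2 ^ (k + 1))) ^ (1 / 2 : ℝ) = 2 ^ (k + 1) * s₀ :=
    sqrt_volume_ball_two_pow c (k + 1)
  -- triangle: v = (v − m₁) + m₁
  have htri : eLpNorm v 2 (volume.restrict (ball c (2 ^ (k + 1))))
      ≤ eLpNorm (fun x => v x - m₁) 2 (volume.restrict (ball c (2 ^ (k + 1))))
        + eLpNorm (fun _ : EuclideanSpace ℝ (Fin 2) => m₁) 2 (volume.restrict (ball c (2 ^ (k + 1)))) := by
    have heq : v = (fun x => v x - m₁) + (fun _ : EuclideanSpace ℝ (Fin 2) => m₁) := by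
      funext x; simp only [Pi.add_apply, sub_add_cancel]
    conv_lhs => rw [heq]
    exact eLpNorm_add_le (hvm.restrict.sub aestronglyMeasurable_const) aestronglyMeasurable_const (by norm_num)
  rw [eLpNorm_const_two_ball m₁ c h2k1, hvolk] at htri
  -- ‖m₁‖ₑ·2^{k+1}·s₀ ≤ 2^{k+1}(N₀ s₀ + (k+1)·3C·EG)
  calc eLpNorm v 2 (volume.restrict (ball c (2 ^ (k + 1))))
      ≤ C * 2 ^ (k + 1) * EG + ‖m₁‖ₑ * (2 ^ (k + 1) * s₀) := htri.trans (add_le_add hP le_rfl)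
    _ = 2 ^ (k + 1) * (C * EG + ‖m₁‖ₑ * s₀) := by ring
    _ ≤ 2 ^ (k + 1) * (C * EG + (N₀ * s₀ + ((k + 1 : ℕ) : ℝ≥0∞) * (3 * C * EG))) := by gcongr
    _ ≤ 2 ^ (k + 1) * ((k + 2 : ℕ) : ℝ≥0∞) * (C * EG + N₀ * s₀ + 3 * C * EG) := by
        have h1 : C * EG + (N₀ * s₀ + ((k + 1 : ℕ) : ℝ≥0∞) * (3 * C * EG))
            ≤ ((k + 2 : ℕ) : ℝ≥0∞) * (C * EG + N₀ * s₀ + 3 * C * EG) := by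
          have hk : (1 : ℝ≥0∞) ≤ ((k + 2 : ℕ) : ℝ≥0∞) := by exact_mod_cast (by omega : 1 ≤ k + 2)
          have hk' : ((k + 1 : ℕ) : ℝ≥0∞) ≤ ((k + 2 : ℕ) : ℝ≥0∞) := by exact_mod_cast (by omega : k + 1 ≤ k + 2)
          calc C * EG + (N₀ * s₀ + ((k + 1 : ℕ) : ℝ≥0∞) * (3 * C * EG))
              = (C * EG + N₀ * s₀) + ((k + 1 : ℕ) : ℝ≥0∞) * (3 * C * EG) := by ring
            _ ≤ ((k + 2 : ℕ) : ℝ≥0∞) * (C * EG + N₀ * s₀) + ((k + 2 : ℕ) : ℝ≥0∞) * (3 * C * EG) := by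
                refine add_le_add ?_ (mul_le_mul_of_nonneg_right hk' zero_le)
                calc (C * EG + N₀ * s₀) = 1 * (C * EG + N₀ * s₀) := (one_mul _).symm
                  _ ≤ ((k + 2 : ℕ) : ℝ≥0∞) * (C * EG + N₀ * s₀) := mul_le_mul_of_nonneg_right hk zero_le
            _ = ((k + 2 : ℕ) : ℝ≥0∞) * (C * EG + N₀ * s₀ + 3 * C * EG) := by ring
        calc 2 ^ (k + 1) * (C * EG + (N₀ * s₀ + ((k + 1 : ℕ) : ℝ≥0∞) * (3 * C * EG)))
            ≤ 2 ^ (k + 1) * (((k + 2 : ℕ) : ℝ≥0∞) * (C * EG + N₀ * s₀ + 3 * C * EG)) :=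
              mul_le_mul_of_nonneg_left h1 zero_le
          _ = 2 ^ (k + 1) * ((k + 2 : ℕ) : ℝ≥0∞) * (C * EG + N₀ * s₀ + 3 * C * EG) := by ring

/-! ### The decay row -/

/-- **Decay at infinity, `‖∇v‖²` form.**  For `v ∈ W^{1,1}_loc(ℝ²)` with `v ∈ L²_loc` and `∫‖∇v‖² < ∞`:
`x ↦ v(x)²/‖x − c‖⁴` is integrable on `{‖x − c‖ > 1}`, for every centre `c`.  No equation and no bound on the means is
assumed (the dyadic means grow at most linearly in the dyadic scale, which the weight `4^{−k}` absorbs). [folklore] -/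
theorem integrableOn_sq_div_norm_pow_four_of_norm_sq
    (hv : HasWeakFDerivOn (⟨univ, isOpen_univ⟩ : Opens (EuclideanSpace ℝ (Fin 2))) volume v Gv)
    (hv2 : LocallyIntegrable (fun y => v y ^ 2)) (hGv : Integrable (fun y => ‖Gv y‖ ^ 2))
    (c : EuclideanSpace ℝ (Fin 2)) :
    IntegrableOn (fun x => v x ^ 2 * ((‖x - c‖ ^ 2)⁻¹) ^ 2) {x | 1 < dist x c} := by
  -- measurability and the energy
  have hvm : AEStronglyMeasurable v volume :=
    (locallyIntegrableOn_univ.mp hv.locallyIntegrableOn).aestronglyMeasurable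
  have hGm : AEStronglyMeasurable Gv volume :=
    (locallyIntegrableOn_univ.mp hv.locallyIntegrableOn_deriv).aestronglyMeasurable
  have hGvM : MemLp Gv 2 volume := (memLp_two_iff_integrable_sq_norm hGm).2 hGv
  obtain ⟨C, hC⟩ := exists_eLpNorm_sub_average_le_mul_radius
    (E := EuclideanSpace ℝ (Fin 2)) (F := ℝ) (p := 2) (by norm_num)
  set EG := eLpNorm Gv 2 volume with hEG
  have hEGt : EG ≠ ⊤ := hGvM.eLpNorm_ne_top
  set s₀ := volume (ball c 1) ^ (1 / 2 : ℝ) with hs₀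
  have hs₀t : s₀ ≠ ⊤ := (sqrt_volume_ball_one_ne c).2
  set N₀ := ‖⨍ y in ball c 1, v y‖ₑ with hN₀
  set T : ℝ≥0∞ := C * EG + N₀ * s₀ + 3 * C * EG with hT
  have hTt : T ≠ ⊤ := by
    rw [hT]
    have h1 : (C : ℝ≥0∞) * EG ≠ ⊤ := ENNReal.mul_ne_top ENNReal.coe_ne_top hEGt
    have h2 : N₀ * s₀ ≠ ⊤ := ENNReal.mul_ne_top enorm_ne_top hs₀t
    have h3 : 3 * (C : ℝ≥0∞) * EG ≠ ⊤ :=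
      ENNReal.mul_ne_top (ENNReal.mul_ne_top (by norm_num) ENNReal.coe_ne_top) hEGt
    exact ENNReal.add_ne_top.2 ⟨ENNReal.add_ne_top.2 ⟨h1, h2⟩, h3⟩
  -- the integrand
  have hfm : AEStronglyMeasurable (fun x => v x ^ 2 * ((‖x - c‖ ^ 2)⁻¹) ^ 2) volume := by
    refine (hvm.pow 2).mul ?_
    exact (Measurable.aestronglyMeasurable (by fun_prop))
  refine ⟨hfm.restrict, ?_⟩
  -- dyadic annuli
  set A : ℕ → Set (EuclideanSpace ℝ (Fin 2)) :=
    fun k => {x | (2 : ℝ) ^ k ≤ dist x c ∧ dist x c < 2 ^ (k + 1)} with hA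
  have hAm : ∀ k, MeasurableSet (A k) := by
    intro k
    have hd : Continuous fun x : EuclideanSpace ℝ (Fin 2) => dist x c := continuous_id.dist continuous_const
    exact (isClosed_le continuous_const hd).measurableSet.inter (isOpen_lt hd continuous_const).measurableSet
  have hcover : {x : EuclideanSpace ℝ (Fin 2) | 1 < dist x c} ⊆ ⋃ k, A k := by
    intro x hx
    have hx' : 1 < dist x c := hx
    obtain ⟨k, hk1, hk2⟩ := exists_nat_pow_near hx'.le one_lt_two
    exact mem_iUnion.2 ⟨k, hk1, hk2⟩
  -- the bound on one annulus
  have hterm : ∀ k : ℕ, ∫⁻ x in A k, ‖v x ^ 2 * ((‖x - c‖ ^ 2)⁻¹) ^ 2‖ₑ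
      ≤ (4 : ℝ≥0∞)⁻¹ ^ k * (4 * (((k : ℝ≥0∞) + 2) ^ 2 * T ^ 2)) := by
    intro k
    set Wk : ℝ≥0∞ := ENNReal.ofReal (((4 : ℝ)⁻¹ ^ k) ^ 2) with hWk
    have hWkt : Wk ≠ ⊤ := ENNReal.ofReal_ne_top
    -- pointwise on the annulus
    have hpt : ∀ x ∈ A k, ‖v x ^ 2 * ((‖x - c‖ ^ 2)⁻¹) ^ 2‖ₑ ≤ ‖v x‖ₑ ^ 2 * Wk := by
      intro x hx
      have hx1 : (2 : ℝ) ^ k ≤ ‖x - c‖ := by rw [← dist_eq_norm]; exact hx.1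
      have hw0 : 0 ≤ ((‖x - c‖ ^ 2)⁻¹) ^ 2 := by positivity
      have hw : ‖((‖x - c‖ ^ 2)⁻¹) ^ 2‖ₑ ≤ Wk := by
        rw [Real.enorm_eq_ofReal hw0]
        exact ENNReal.ofReal_le_ofReal (weight_le_of_le_norm hx1)
      calc ‖v x ^ 2 * ((‖x - c‖ ^ 2)⁻¹) ^ 2‖ₑ = ‖v x‖ₑ ^ 2 * ‖((‖x - c‖ ^ 2)⁻¹) ^ 2‖ₑ := by
            rw [enorm_mul, enorm_pow]
        _ ≤ ‖v x‖ₑ ^ 2 * Wk := mul_le_mul_of_nonneg_left hw zero_le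
    have hsub : A k ⊆ ball c (2 ^ (k + 1)) := fun x hx => mem_ball.2 hx.2
    have hL := eLpNorm_dyadic_ball_le hC hv hv2 hGvM c k
    calc ∫⁻ x in A k, ‖v x ^ 2 * ((‖x - c‖ ^ 2)⁻¹) ^ 2‖ₑ
        ≤ ∫⁻ x in A k, ‖v x‖ₑ ^ 2 * Wk := setLIntegral_mono' (hAm k) hpt
      _ = (∫⁻ x in A k, ‖v x‖ₑ ^ 2) * Wk := lintegral_mul_const' _ _ hWkt
      _ ≤ (∫⁻ x in ball c (2 ^ (k + 1)), ‖v x‖ₑ ^ 2) * Wk :=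
          mul_le_mul_of_nonneg_right (lintegral_mono_set hsub) zero_le
      _ = eLpNorm v 2 (volume.restrict (ball c (2 ^ (k + 1)))) ^ 2 * Wk := by
          rw [eLpNorm_two_sq_eq_lintegral]
      _ ≤ (2 ^ (k + 1) * ((k + 2 : ℕ) : ℝ≥0∞) * T) ^ 2 * Wk := by gcongr
      _ = (4 : ℝ≥0∞)⁻¹ ^ k * (4 * (((k : ℝ≥0∞) + 2) ^ 2 * T ^ 2)) := by
          rw [mul_pow, mul_pow, two_pow_succ_sq, ← ofReal_weight_mul_four_pow k]
          push_cast
          ring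
  -- summation
  have hsum : (∑' k : ℕ, (4 : ℝ≥0∞)⁻¹ ^ k * (4 * (((k : ℝ≥0∞) + 2) ^ 2 * T ^ 2))) ≠ ⊤ := by
    have heq : (fun k : ℕ => (4 : ℝ≥0∞)⁻¹ ^ k * (4 * (((k : ℝ≥0∞) + 2) ^ 2 * T ^ 2)))
        = fun k : ℕ => (((k : ℝ≥0∞) + 2) ^ 2 * (4 : ℝ≥0∞)⁻¹ ^ k) * (4 * T ^ 2) := by
      funext k; ring
    rw [heq, ENNReal.tsum_mul_right]
    exact ENNReal.mul_ne_top tsum_sq_mul_geometric_ne_top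
      (ENNReal.mul_ne_top (by norm_num) (ENNReal.pow_ne_top hTt))
  -- assembly
  unfold HasFiniteIntegral
  calc ∫⁻ x in {x | 1 < dist x c}, ‖v x ^ 2 * ((‖x - c‖ ^ 2)⁻¹) ^ 2‖ₑ
      ≤ ∫⁻ x in ⋃ k, A k, ‖v x ^ 2 * ((‖x - c‖ ^ 2)⁻¹) ^ 2‖ₑ := lintegral_mono_set hcover
    _ ≤ ∑' k, ∫⁻ x in A k, ‖v x ^ 2 * ((‖x - c‖ ^ 2)⁻¹) ^ 2‖ₑ := lintegral_iUnion_le _ _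
    _ ≤ ∑' k : ℕ, (4 : ℝ≥0∞)⁻¹ ^ k * (4 * (((k : ℝ≥0∞) + 2) ^ 2 * T ^ 2)) := ENNReal.tsum_le_tsum hterm
    _ < ⊤ := lt_top_iff_ne_top.2 hsum

/-- **Decay at infinity** — the row consumed by the removable-pole step of brick W-INV, in its letters
(`e k = EuclideanSpace.single k 1`): for `v ∈ W^{1,1}_loc(ℝ²)` with `v ∈ L²_loc` and `∫ Σ_k (∂_k v)² < ∞`, the function
`x ↦ v(x)²·((‖x − c‖²)⁻¹)²` is integrable on `{x | 1 < dist x c}`, for every centre `c` — no equation, valid for the head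
`u` AND the partners `a, b` of an admissible triple alike. [folklore] -/
theorem integrableOn_sq_div_norm_pow_four
    (hv : HasWeakFDerivOn (⟨univ, isOpen_univ⟩ : Opens (EuclideanSpace ℝ (Fin 2))) volume v Gv)
    (hv2 : LocallyIntegrable (fun y => v y ^ 2))
    (hGv : Integrable (fun y => ∑ k : Fin 2, (Gv y (EuclideanSpace.single k (1 : ℝ))) ^ 2))
    (c : EuclideanSpace ℝ (Fin 2)) :
    IntegrableOn (fun x => v x ^ 2 * ((‖x - c‖ ^ 2)⁻¹) ^ 2) {x | 1 < dist x c} := by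
  have hGm : AEStronglyMeasurable Gv volume :=
    (locallyIntegrableOn_univ.mp hv.locallyIntegrableOn_deriv).aestronglyMeasurable
  have hGv' : Integrable (fun y => ‖Gv y‖ ^ 2) := by
    refine hGv.mono' (hGm.norm.pow 2) (Eventually.of_forall fun y => ?_)
    rw [Real.norm_eq_abs, abs_of_nonneg (sq_nonneg _), opNorm_sq_eq_sum_sq]
  exact integrableOn_sq_div_norm_pow_four_of_norm_sq hv hv2 hGv' c

end Decay

end Summit.QuantumFields.YangMills.Theorems.PoincareLipschitzSobolevPlanarDecay

end
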